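import Literature.AlgebraicGeometry.AbelianSchemes.AbelianLiftObstructionClass
import Literature.AlgebraicGeometry.HodgeTheory.HodgeSheafPullbackForms
import Literature.AlgebraicGeometry.Modules.PullbackSectionsBaseChange
import HarnessLib

/-!
# An automorphism of the abelian scheme over the base acts on the canonical closed fibre: the square, the sections, the closed-fibre
# identification `s̄ = σ_κ♯` ([Oort1971] (2.2.1), first proof p. 279: «`-1` acts on the lifting problem»; [GortzWedhorn2020] (4.7))

Layer `Literature/AlgebraicGeometry/AbelianSchemes`, namespace `Literature.AlgebraicGeometry.AbelianSchemes.AbelianSchemeOver`.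
PROOF FILE, THEOREMS ONLY (no definition, no instance, no notation, no named fact, no `sorry`).  Cell `hodgecm-mathlib`, P6 sub-desk P6b,
(U-ab) plate organ (O6) stage (S1)–(S2b) (count-neutral ★ capital on `--supports stmt-HodgeConjecture-24832`): the scheme-side letters the
(O6) assembler feeds to ★ (vii-d) `SmoothLiftAtlasTransportQuot` (`hσ`) and to its `reading_transport` (the closed-fibre identification `s̄`
and `hsbar : s̄ ∘ π = π ∘ σ♯`) for an automorphism `σ` of `X₀` OVER `Spec (A⧸J)` — the case of record being the inversion `ι[X₀.X]`.

SETTING ((D) letters, ★ `AbelianLiftObstructionClass`): `A` Artin local, `J ≠ ⊤`, `X₀ : AbelianSchemeOver (Spec (A⧸J))`, the canonical closed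
fibre `closedFibre hJ X₀ = X₀ ×_{A⧸J} κ(A)` with `pr₁ = closedFibreι hJ X₀`; sections of `X₀` are `A`-algebras through `X₀ → Spec (A⧸J) → Spec A`
(the (D) `letI`), sections of the closed fibre through `κ(A)` (`halgκ`).  For an endomorphism `σ : X₀.X ⟶ X₀.X` over the base:
* §1 `fibreMap σ := pullback.lift (pr₁ ≫ σ.left) pr₂ _` — stated through its two defining equations only (no definition is introduced: the
  assembler names the term); `fibreMap_fst` (THE SQUARE `σ_κ ≫ pr₁ = pr₁ ≫ σ`), `fibreMap_snd` (over `Spec κ(A)`); for `σ = ι[X₀.X]` this term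
  is ★ `AbelianVarietyCech.inv (closedFibre hJ X₀)` (A-p12 (g32) probe, `rfl`).
* §2 **`app_algebraMap_of_over`** — `σ♯_W (a·1) = a·1`: the `hσ` letter of ★ (vii-d) for the (D) algebra structures.
* §3 **`exists_closedFibreTransportEquiv`** — for `σ` an isomorphism: `A`-algebra isomorphisms
  `s̄_W : Γ(X_κ, pr₁⁻¹W) ≃ₐ[A] Γ(X_κ, pr₁⁻¹σ⁻¹W)` acting as `σ_κ.appLE` (bijective because `σ_κ` is an isomorphism and the two opens agree by the
  square; `A`-linear by ★ `appLE_constToPresheaf`), with **`hsbar`**: `s̄_W (π_W x) = π_{σ⁻¹W} (σ♯ x)` for the PINNED layer `π = pr₁^♯` (`hπi`).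

HC_CM is proved only modulo the printed citations until rung 0 closes; nothing here bears on a summit statement.
## References
* [Oort1971] F. Oort, *Finite group schemes, local moduli for abelian varieties, and lifting problems*, Compositio Math. 23 (1971), Thm. (2.2.1)
  (p. 273) and its first proof (pp. 279–280).
* [GortzWedhorn2020] U. Görtz, T. Wedhorn, *Algebraic Geometry I: Schemes*, 2nd ed. (2020), Section (4.7) (pp. 107–108), Prop. 4.16 (pp. 101–104).
-/

noncomputable section

set_option backward.isDefEq.respectTransparency false

open CategoryTheory CategoryTheory.Limits AlgebraicGeometry TopologicalSpace Opposite
open Literature.AlgebraicGeometry.Morphisms Literature.AlgebraicGeometry.HodgeTheory Literature.AlgebraicGeometry.Modules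
  Literature.AlgebraicGeometry.Motives

namespace Literature.AlgebraicGeometry.AbelianSchemes.AbelianSchemeOver

variable {A : Type} [CommRing A] [IsLocalRing A] {J : Ideal A} (hJ : J ≠ ⊤)
  (X₀ : AbelianSchemeOver (Spec (.of (A ⧸ J)))) (σ : X₀.X ⟶ X₀.X)

/-! ## §1 The induced endomorphism of the canonical closed fibre -/

/-- The compatibility making `pullback.lift (pr₁ ≫ σ) pr₂` legal: `(pr₁ ≫ σ) ≫ f₀ = pr₂ ≫ r` (`σ` is over the base).
[cite: GortzWedhorn2020, Section (4.7) (pp. 107–108)] -/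
theorem fst_comp_left_comp_hom :
    (closedFibreι hJ X₀ ≫ σ.left) ≫ X₀.X.hom = pullback.snd X₀.X.hom (residueBaseMap hJ) ≫ residueBaseMap hJ := by
  rw [Category.assoc, Over.w σ]
  exact pullback.condition

/-- **THE SQUARE** `σ_κ ≫ pr₁ = pr₁ ≫ σ` for `σ_κ := pullback.lift (pr₁ ≫ σ) pr₂ _`. [cite: GortzWedhorn2020, Section (4.7) (pp. 107–108)] -/
theorem fibreMap_fst :
    pullback.lift (closedFibreι hJ X₀ ≫ σ.left) (pullback.snd X₀.X.hom (residueBaseMap hJ)) (fst_comp_left_comp_hom hJ X₀ σ) ≫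
        closedFibreι hJ X₀ = closedFibreι hJ X₀ ≫ σ.left :=
  pullback.lift_fst _ _ _

/-- `σ_κ` is over `Spec κ(A)`: `σ_κ ≫ pr₂ = pr₂`. [cite: GortzWedhorn2020, Section (4.7) (pp. 107–108)] -/
theorem fibreMap_snd :
    pullback.lift (closedFibreι hJ X₀ ≫ σ.left) (pullback.snd X₀.X.hom (residueBaseMap hJ)) (fst_comp_left_comp_hom hJ X₀ σ) ≫
        pullback.snd X₀.X.hom (residueBaseMap hJ) = pullback.snd X₀.X.hom (residueBaseMap hJ) :=
  pullback.lift_snd _ _ _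

/-- `σ_κ` is a morphism over `Spec κ(A)` in the sense of `Over`: `σ_κ ≫ (closedFibre).X.hom = (closedFibre).X.hom`.
[cite: GortzWedhorn2020, Section (4.7) (pp. 107–108)] -/
theorem fibreMap_comp_hom :
    pullback.lift (closedFibreι hJ X₀ ≫ σ.left) (pullback.snd X₀.X.hom (residueBaseMap hJ)) (fst_comp_left_comp_hom hJ X₀ σ) ≫
        (closedFibre hJ X₀).X.hom = (closedFibre hJ X₀).X.hom :=
  fibreMap_snd hJ X₀ σ

/-- The opens: `pr₁⁻¹(σ⁻¹W) = σ_κ⁻¹(pr₁⁻¹W)`. [cite: GortzWedhorn2020, Section (4.7) (pp. 107–108)] -/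
theorem preimage_preimage_eq (W : X₀.X.left.Opens) :
    closedFibreι hJ X₀ ⁻¹ᵁ (σ.left ⁻¹ᵁ W) =
      pullback.lift (closedFibreι hJ X₀ ≫ σ.left) (pullback.snd X₀.X.hom (residueBaseMap hJ)) (fst_comp_left_comp_hom hJ X₀ σ) ⁻¹ᵁ
        (closedFibreι hJ X₀ ⁻¹ᵁ W) := by
  change (closedFibreι hJ X₀ ≫ σ.left) ⁻¹ᵁ W =
    (pullback.lift (closedFibreι hJ X₀ ≫ σ.left) (pullback.snd X₀.X.hom (residueBaseMap hJ)) (fst_comp_left_comp_hom hJ X₀ σ) ≫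
      closedFibreι hJ X₀) ⁻¹ᵁ W
  rw [fibreMap_fst]

/-- If `σ` is an isomorphism of schemes, so is `σ_κ` (its inverse is the lift of `σ⁻¹`). [cite: GortzWedhorn2020, Section (4.7) (pp. 107–108)] -/
theorem isIso_fibreMap [IsIso σ] :
    IsIso (pullback.lift (closedFibreι hJ X₀ ≫ σ.left) (pullback.snd X₀.X.hom (residueBaseMap hJ))
      (fst_comp_left_comp_hom hJ X₀ σ)) := by
  refine ⟨pullback.lift (closedFibreι hJ X₀ ≫ (inv σ).left) (pullback.snd X₀.X.hom (residueBaseMap hJ))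
    (fst_comp_left_comp_hom hJ X₀ (inv σ)), ?_, ?_⟩
  · apply pullback.hom_ext
    · rw [Category.assoc, pullback.lift_fst, ← Category.assoc, pullback.lift_fst, Category.assoc, ← Over.comp_left,
        IsIso.hom_inv_id, Over.id_left, Category.comp_id, Category.id_comp]
    · rw [Category.assoc, pullback.lift_snd, pullback.lift_snd, Category.id_comp]
  · apply pullback.hom_ext
    · rw [Category.assoc, pullback.lift_fst, ← Category.assoc, pullback.lift_fst, Category.assoc, ← Over.comp_left,
        IsIso.inv_hom_id, Over.id_left, Category.comp_id, Category.id_comp]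
    · rw [Category.assoc, pullback.lift_snd, pullback.lift_snd, Category.id_comp]

/-! ## §2 `σ♯` is an `A`-algebra map on sections (the `hσ` letter of ★ (vii-d)) -/

omit [IsLocalRing A] in
/-- **`σ♯_W (a·1) = a·1`** for the (D) `A`-algebra structures on the sections of `X₀` (through `X₀ → Spec (A⧸J) → Spec A`): `σ` is over the base,
so `σ♯ ∘ f₀♯ = f₀♯` (Mathlib `Scheme.Hom.appLE_comp_appLE`). [cite: GortzWedhorn2020, Prop. 4.16 (pp. 101–104)]
[cite: Oort1971, proof of Thm. (2.2.1), pp. 279–280] -/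
theorem app_algebraMap_of_over (W : X₀.X.left.Opens) (a : A) :
    letI : ∀ W : X₀.X.left.Opens, Algebra A Γ(X₀.X.left, W) := fun W =>
      (((Scheme.ΓSpecIso (.of (A ⧸ J))).inv ≫ X₀.X.hom.appLE ⊤ W le_top).hom.comp (Ideal.Quotient.mk J)).toAlgebra
    σ.left.app W (algebraMap A Γ(X₀.X.left, W) a) = algebraMap A Γ(X₀.X.left, σ.left ⁻¹ᵁ W) a := by
  show σ.left.app W (((Scheme.ΓSpecIso (.of (A ⧸ J))).inv ≫ X₀.X.hom.appLE ⊤ W le_top) (Ideal.Quotient.mk J a)) =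
    ((Scheme.ΓSpecIso (.of (A ⧸ J))).inv ≫ X₀.X.hom.appLE ⊤ (σ.left ⁻¹ᵁ W) le_top) (Ideal.Quotient.mk J a)
  rw [Scheme.Hom.app_eq_appLE, ← CommRingCat.comp_apply, Category.assoc, Scheme.Hom.appLE_comp_appLE, Over.w σ]

/-! ## §3 The closed-fibre identification `s̄ = σ_κ♯` -/

variable [instΓκ : ∀ W : (closedFibre hJ X₀).X.left.Opens, Algebra A Γ((closedFibre hJ X₀).X.left, W)]
  (halgκ : ∀ (W : (closedFibre hJ X₀).X.left.Opens) (a : A), algebraMap A Γ((closedFibre hJ X₀).X.left, W) a =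
    (constToPresheaf (closedFibre hJ X₀).X).app (op W) (algebraMap A (IsLocalRing.ResidueField A) a))

include halgκ in
/-- **THE CLOSED-FIBRE IDENTIFICATION `s̄`**: for `σ` an isomorphism over the base there are `A`-algebra ISOMORPHISMS
`s̄_W : Γ(X_κ, pr₁⁻¹W) ≃ₐ[A] Γ(X_κ, pr₁⁻¹σ⁻¹W)` acting as `σ_κ.appLE` — bijective since `σ_κ` is an isomorphism and `pr₁⁻¹σ⁻¹W = σ_κ⁻¹pr₁⁻¹W`,
`A`-linear since `σ_κ` is over `Spec κ(A)` (★ `appLE_constToPresheaf`). [cite: GortzWedhorn2020, Section (4.7) (pp. 107–108)]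
[cite: Oort1971, proof of Thm. (2.2.1), pp. 279–280] -/
theorem exists_closedFibreTransportEquiv [IsIso σ] :
    ∃ sbar : (W : X₀.X.left.Opens) →
        (Γ((closedFibre hJ X₀).X.left, closedFibreι hJ X₀ ⁻¹ᵁ W) ≃ₐ[A]
          Γ((closedFibre hJ X₀).X.left, closedFibreι hJ X₀ ⁻¹ᵁ (σ.left ⁻¹ᵁ W))),
      ∀ (W : X₀.X.left.Opens) (x : Γ((closedFibre hJ X₀).X.left, closedFibreι hJ X₀ ⁻¹ᵁ W)),
        sbar W x =
          (pullback.lift (closedFibreι hJ X₀ ≫ σ.left) (pullback.snd X₀.X.hom (residueBaseMap hJ))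
              (fst_comp_left_comp_hom hJ X₀ σ)).appLE (closedFibreι hJ X₀ ⁻¹ᵁ W) (closedFibreι hJ X₀ ⁻¹ᵁ (σ.left ⁻¹ᵁ W))
            (preimage_preimage_eq hJ X₀ σ W).le x := by
  -- the underlying ring maps, bijective (iso + equal opens), `A`-linear (over `Spec κ`)
  set σκ := pullback.lift (closedFibreι hJ X₀ ≫ σ.left) (pullback.snd X₀.X.hom (residueBaseMap hJ))
    (fst_comp_left_comp_hom hJ X₀ σ) with hσκ
  haveI : IsIso σκ := isIso_fibreMap hJ X₀ σ
  have hbij : ∀ W : X₀.X.left.Opens, Function.Bijective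
      (σκ.appLE (closedFibreι hJ X₀ ⁻¹ᵁ W) (closedFibreι hJ X₀ ⁻¹ᵁ (σ.left ⁻¹ᵁ W)) (preimage_preimage_eq hJ X₀ σ W).le) := by
    intro W
    have heq := preimage_preimage_eq hJ X₀ σ W
    -- `appLE U V h = app U ≫ map (homOfLE h)`, both isomorphisms
    haveI : IsIso ((closedFibre hJ X₀).X.left.presheaf.map
        (homOfLE (preimage_preimage_eq hJ X₀ σ W).le :
          closedFibreι hJ X₀ ⁻¹ᵁ (σ.left ⁻¹ᵁ W) ⟶ σκ ⁻¹ᵁ (closedFibreι hJ X₀ ⁻¹ᵁ W)).op) := by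
      have : homOfLE (preimage_preimage_eq hJ X₀ σ W).le = (eqToIso heq).hom := Subsingleton.elim _ _
      rw [this]
      infer_instance
    haveI : IsIso (σκ.appLE (closedFibreι hJ X₀ ⁻¹ᵁ W) (closedFibreι hJ X₀ ⁻¹ᵁ (σ.left ⁻¹ᵁ W))
        (preimage_preimage_eq hJ X₀ σ W).le) := by
      rw [Scheme.Hom.appLE]
      infer_instance
    exact ConcreteCategory.bijective_of_isIso _
  have hlin : ∀ (W : X₀.X.left.Opens) (a : A),
      σκ.appLE (closedFibreι hJ X₀ ⁻¹ᵁ W) (closedFibreι hJ X₀ ⁻¹ᵁ (σ.left ⁻¹ᵁ W)) (preimage_preimage_eq hJ X₀ σ W).le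
        (algebraMap A Γ((closedFibre hJ X₀).X.left, closedFibreι hJ X₀ ⁻¹ᵁ W) a) =
        algebraMap A Γ((closedFibre hJ X₀).X.left, closedFibreι hJ X₀ ⁻¹ᵁ (σ.left ⁻¹ᵁ W)) a := by
    intro W a
    rw [halgκ, halgκ]
    exact appLE_constToPresheaf (Over.homMk σκ (fibreMap_comp_hom hJ X₀ σ) : (closedFibre hJ X₀).X ⟶ (closedFibre hJ X₀).X)
      _ _ _ _
  refine ⟨fun W => AlgEquiv.ofBijective
    ({ toRingHom := (σκ.appLE (closedFibreι hJ X₀ ⁻¹ᵁ W) (closedFibreι hJ X₀ ⁻¹ᵁ (σ.left ⁻¹ᵁ W))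
        (preimage_preimage_eq hJ X₀ σ W).le).hom
       commutes' := hlin W } :
      Γ((closedFibre hJ X₀).X.left, closedFibreι hJ X₀ ⁻¹ᵁ W) →ₐ[A]
        Γ((closedFibre hJ X₀).X.left, closedFibreι hJ X₀ ⁻¹ᵁ (σ.left ⁻¹ᵁ W))) (hbij W), fun W x => rfl⟩

omit instΓκ in
/-- **`hsbar`: `s̄_W (π_W x) = π_{σ⁻¹W} (σ♯ x)`** for the pinned closed-fibre layer `π = pr₁^♯` (`hπi`): the square `σ_κ ≫ pr₁ = pr₁ ≫ σ` read on
sections (★ `appLE_appLE_eq_of_comm_sq`). [cite: GortzWedhorn2020, Prop. 4.16 (pp. 101–104)] [cite: Oort1971, proof of Thm. (2.2.1), pp. 279–280] -/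
theorem sbar_pinned
    (π : (W : X₀.X.left.Opens) → Γ(X₀.X.left, W) → Γ((closedFibre hJ X₀).X.left, closedFibreι hJ X₀ ⁻¹ᵁ W))
    (hπi : ∀ (W : X₀.X.left.Opens) (x : Γ(X₀.X.left, W)), π W x = (closedFibreι hJ X₀).app W x)
    (sbar : (W : X₀.X.left.Opens) →
        (Γ((closedFibre hJ X₀).X.left, closedFibreι hJ X₀ ⁻¹ᵁ W) →
          Γ((closedFibre hJ X₀).X.left, closedFibreι hJ X₀ ⁻¹ᵁ (σ.left ⁻¹ᵁ W))))
    (hs : ∀ (W : X₀.X.left.Opens) (x : Γ((closedFibre hJ X₀).X.left, closedFibreι hJ X₀ ⁻¹ᵁ W)),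
        sbar W x =
          (pullback.lift (closedFibreι hJ X₀ ≫ σ.left) (pullback.snd X₀.X.hom (residueBaseMap hJ))
              (fst_comp_left_comp_hom hJ X₀ σ)).appLE (closedFibreι hJ X₀ ⁻¹ᵁ W) (closedFibreι hJ X₀ ⁻¹ᵁ (σ.left ⁻¹ᵁ W))
            (preimage_preimage_eq hJ X₀ σ W).le x)
    (W : X₀.X.left.Opens) (x : Γ(X₀.X.left, W)) :
    sbar W (π W x) = π (σ.left ⁻¹ᵁ W) (σ.left.app W x) := by
  rw [hs, hπi, hπi, Scheme.Hom.app_eq_appLE, Scheme.Hom.app_eq_appLE, Scheme.Hom.app_eq_appLE]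
  have h := appLE_appLE_eq_of_comm_sq (fibreMap_fst hJ X₀ σ)
    (le_refl (σ.left ⁻¹ᵁ W)) (le_refl (closedFibreι hJ X₀ ⁻¹ᵁ W))
    (UY := closedFibreι hJ X₀ ⁻¹ᵁ (σ.left ⁻¹ᵁ W))
    (by rw [← preimage_preimage_eq hJ X₀ σ W]; exact (inf_idem _).symm) x
  exact h

end Literature.AlgebraicGeometry.AbelianSchemes.AbelianSchemeOver

end
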